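/-
Origin: expansion seat `planner-pub-hodgecm-mc-axioms-1-g14-0`, handover #W172 2026-08-20T15:53:55Z md5 542ce7ccd15e (PKG 888f7816d963 → 542ce7ccd15e; 286 l.; MECHANICAL (iib-R) rewrite v3.1 of the PKG file as it stands (140 token edits; rules R1x3+RX[h₂]x137)) (`HOME/mc/pub-hodgecm-mc-axioms-1-g14/revendor/kit-r55/stage55/HodgeCM/Model/HypCensus/SideE.lean`, md5 542ce7ccd15e, 286 lines);
landed by the gen-22 packager (p-g22) in gate run 55 REPLACES the earlier landed copy of `HodgeCM/Model/HypCensus/SideE.lean` (seat copy carried the packager Origin header of an earlier run (stripped)).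
-/
/-
Origin: speedrun cell pub-hodgecm, MODEL-CONSTRUCTION sub-cell, lineage mc-binder-2 (BINDER-OWNERS rows 18/19: E binders
`hyp12` / `hyp34` of `Model.perL_picardCM_r15A`), seat prover-pub-hodgecm-mc-binder-2-g8-0 (gen 8), 2026-08-19.
Target in PKG: `HodgeCM/Model/HypCensus/SideE.lean` (NEW additive leaf; imports this kit's `HypCensus/SideW`, the E pin `Model/E2InstanceR15A`
(RUN 35) and binder-1's `Model/Binders/GramWRegime` (RUN 36); nothing landed imports it).  KERNEL ONLY: 0 records, nothing cited,
0 `def … : Prop`; the junction statements are FIELDS of the record `HypSideW` (hypotheses of the final theorems).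
-/
import Summits.HodgeConjecture.HodgeCM.Model.HypCensus.SideW
import Summits.HodgeConjecture.HodgeCM.Model.E2InstanceR15A
import Summits.HodgeConjecture.HodgeCM.Model.Binders.GramWRegime

/-!
# E's binders `hyp12` / `hyp34` REDUCED to a six-field side record in the currency of the `wm` input `W V c`

Rows 18/19 of `HOME/BINDER-OWNERS.md`: E's binders

  `hyp12 : ∀ V c, GoodCtx → [c.K : ℚ] = 6 → Nonempty (((coreOf …).toCore h).HypSmoothCore12 (side12 (d12Of μ))
     (side34 (d34Of μ)) ((analyticKM …).toAnalytic) V c (ℓ := linOfInput W V c))`   (and `hyp34`).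

`HypSmoothCore12` = a kind map + scalings + pv06's six-field `ArchC.HypSmoothSide` over the END-STATE core of the pin.
That core is reached from the `wm` input `W V c : WmInput V c.D` through five definitional layers (`wmOf'`,
`toLatticeModels`, `coreOf`, `toCore`, `ThetaModel.ofRegCarrier`).  The sibling leaf `HypCensus/SideW`
states the six fields on `W₀ : WmInput V D` ALONE (`HypSideW W₀ jT kind lam hlam m₁ m₂`): `ins` lands in `𝒮(𝔸_F^ι)` with values in `W₀.SK`; `ω(t)` is `W₀.ρ (1, W₀.eW (jT (ιc t)))` at
  the printed torus point read through `placesCoord` / `placesEquiv` (pv11 `printedTorusHom`, pv07 `toAdeles`); the curves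
  `e_b` run in `U(W)(𝔸)` (`adelicUnitaryGroup L D.gramW`); `dense` and `smooth` are stated in Weil's `Θ`-initial
  topology `ThetaTop` of `W₀.ρ` (the topology the END STATE puts on `𝒮^κ`, `rfl`).
This file peels the five layers ONCE, for every `W`:

* §2 the dictionary (all `rfl` up to `map_one`): the END-STATE `𝒮^κ`, `U(W)(𝔸)`-model, `ω`, topology and linear
  structure of the pin ARE `↥(W V c).SK`, `↥(regimeSubgroup L c.D.gramW)`, `Φ ↦ W.ρ (1, W.eW y) Φ`, the subspace topology
  of `ThetaTop`, the submodule structure.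
* §3 **`hypSmoothSide12_of_sideW` / `nonempty_hypSmoothCore12_of_sideW`** (regime `hW : IsAnisotropic L c.D.gramW`)
  and **`hyp12_of_sideW` : ‹E's `hyp12` VERBATIM›** from `∀ V c, GoodCtx → [c.K:ℚ] = 6 → Nonempty (HypCoreW (W V c)
  c.D.jT₁₂ (-μ c 0) (-μ c 1))` (the regime is DERIVED: binder-1 `isAnisotropic_gramW_of_goodCtx`); §4 the same for (34)
  with `jT₃₄`, `(-μ c 2, -μ c 3)`.

So rows 18/19 now read: E's `hyp12`/`hyp34` ⟸ one `HypCoreW` per good sextic context, a record about `W V c` only —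
which the census kit (`HypCensus/*`: (J-smooth) `SmoothTheta/SmoothTwist`, (J-omg) `TorusBlock/KappaEigen/…Dictionary`,
(J-ins) `InsRaw/InsBlock`, (J-dense) `InvariantSlot*`) instantiates at `W := wmInputCM₂b …` (successor file).
Nothing here is a claim of PerL/QW8: every statement below is proved, the junctions are hypotheses (record fields).
-/

set_option autoImplicit false

noncomputable section

open scoped TensorProduct InnerProductSpace Matrix Topology
open Filter

namespace HodgeCM.Model.HypCensus

open HodgeCM HodgeCM.Model HodgeCM.Universe HodgeCM.Adelic
open HodgeCM.Universe (AdelicThetaCore AdelicThetaCore₀ SideData ThetaModel)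
open HodgeCM.PerL34 HodgeCM.PerL34.ArchC HodgeCM.PerL34.Fock HodgeCM.PerL34.Fock.PrintDict
open Literature.AlgebraicGeometry.HodgeTheory
open Literature.NumberTheory.Automorphic.PicardCM
open Literature.NumberTheory.Transcendental (Arapura2012_Cor_15_4_6)
open Literature.NumberTheory.Automorphic (piSchwartzBruhat)
open Literature.NumberTheory.Weil1964 (repWeilThetaDatum)
open NumberField NumberField.SeesawArchTorus

/-! ## §2 The pin and its dictionary -/

section Pin

variable (hHD : exists_isReal_hodgeModel) (hI : hodgePQ_independent_of_hodgeModel)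
  (h₁ : BallQuotientUniformised)  (h₃ : CMAbelianVarietyRealised)
variable (h : Bool) (hA : Arapura2012_Cor_15_4_6)
  (W : ∀ {L : CMField} {ι₁ : L →+* ℂ} (V : HermSpace3 L ι₁) (c : SeesawCtx L), WmInput V c.D)
  (S : ∀ {L : CMField} {ι₁ : L →+* ℂ} (V : HermSpace3 L ι₁) (c : SeesawCtx L), ThetaAdelicSide V c)
  (μ : ∀ {L : CMField}, SeesawCtx L → Fin 4 → InfinitePlace L → ℤ)

/-- The DATA core of E's pin (binder-1's `pinC`, restated to keep this leaf import-light). -/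
abbrev cpinC : (picardCMUniverse hHD hI h₁ h₃).AdelicThetaCore₀ :=
  coreOf _ (embOf hHD hI h₁ h₃) (coverOf hHD hI h₁ h₃ hA) (wmOfInput W)
    (thetaOf _ (thetaClassInputOf _ (fun V c => thetaSpaceInputOf hHD hI h₁ h₃ S V c)))

/-- The full core of E's pin (sign recipe filled in). -/
abbrev cC : (picardCMUniverse hHD hI h₁ h₃).AdelicTorusCore printFact_unitaryCompact_holds :=
  (cpinC hHD hI h₁ h₃ hA W S).toCore h

/-- E's END-STATE theta model at the pin (`thetaModelOf …`, binder-1's `pinT`). -/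
abbrev cpinT : (picardCMUniverse hHD hI h₁ h₃).ThetaModel :=
  thetaModelOf hHD hI h₁ h₃ h (embOf hHD hI h₁ h₃) (coverOf hHD hI h₁ h₃ hA) (wmOfInput W)
    (thetaOf _ (thetaClassInputOf _ (fun V c => thetaSpaceInputOf hHD hI h₁ h₃ S V c))) (d12Of μ) (d34Of μ)

variable {L : CMField} {ι₁ : L →+* ℂ} (V : HermSpace3 L ι₁) (c : SeesawCtx L)

/-- The (12) residual block of the pin's context. -/
abbrev cR12 : (cC hHD hI h₁ h₃ h hA W S).Rest12 V c := (cC hHD hI h₁ h₃ h hA W S).side12 (d12Of μ) V c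

/-- The (34) residual block of the pin's context. -/
abbrev cR34 : (cC hHD hI h₁ h₃ h hA W S).Rest34 V c := (cC hHD hI h₁ h₃ h hA W S).side34 (d34Of μ) V c

/-- the typed weight exponents of the (12) block ARE `(-μ₀, -μ₁)` (`d12Of`). -/
theorem cR12_m₁ : (cR12 hHD hI h₁ h₃ h hA W S μ V c).m₁ = fun w => -μ c 0 w := rfl
/-- (Ported verbatim from the HodgeCMPerL package; no docstring in the source.) -/
theorem cR12_m₂ : (cR12 hHD hI h₁ h₃ h hA W S μ V c).m₂ = fun w => -μ c 1 w := rfl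
/-- (Ported verbatim from the HodgeCMPerL package; no docstring in the source.) -/
theorem cR34_m₁ : (cR34 hHD hI h₁ h₃ h hA W S μ V c).m₁ = fun w => -μ c 2 w := rfl
/-- (Ported verbatim from the HodgeCMPerL package; no docstring in the source.) -/
theorem cR34_m₂ : (cR34 hHD hI h₁ h₃ h hA W S μ V c).m₂ = fun w => -μ c 3 w := rfl

/-- DICTIONARY 1: the END STATE's `𝒮^κ` of the pin IS `↥(W V c).SK`, a subtype of Weil's `ThetaTop`. -/
theorem cpinT_SK : (cpinT hHD hI h₁ h₃ h hA W S μ).SK V c = ↥((wmOf' printFact_unitaryCompact_holds (W V c)).SK) := rfl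

/-- DICTIONARY 2: its model of `U(W)(𝔸)` IS the regime model group. -/
theorem cpinT_G : (cpinT hHD hI h₁ h₃ h hA W S μ).G V c = ↥(regimeSubgroup L c.D.gramW) := rfl

/-- DICTIONARY 3: its `ω(y)Φ` IS `W.ρ (1, W.eW y) Φ`. -/
theorem val_core_omg (y : (cpinT hHD hI h₁ h₃ h hA W S μ).G V c) (Φ : (cpinT hHD hI h₁ h₃ h hA W S μ).SK V c) :
    Subtype.val (((cpinT hHD hI h₁ h₃ h hA W S μ).core V c).omg y Φ) =
      omgW (W V c) (Subtype.val y) (Subtype.val Φ) := by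
  change ((W V c).ρ ((W V c).eV (Subtype.val (1 : ↥(regimeSubgroup L V.Hm))), (W V c).eW (Subtype.val y)) :
        Module.End ℂ ↥(piSchwartzBruhat (W V c).F (W V c).ι)) Φ.1 = _
  rw [OneMemClass.coe_one, map_one]

/-- DICTIONARY 4: its topology IS the subspace topology of Weil's `ThetaTop`. -/
theorem cpinT_instSK : (inferInstance : TopologicalSpace ((cpinT hHD hI h₁ h₃ h hA W S μ).SK V c)) =
    (instTopologicalSpaceSubtype : TopologicalSpace ↥((wmOf' printFact_unitaryCompact_holds (W V c)).SK)) := rfl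

/-- DICTIONARY 5: the canonical (12) chart at a printed torus point, on adelic matrices (regime of `U(W)`). -/
theorem val_chart12 [DecidableEq (InfinitePlace (L : Type))] (hW : IsAnisotropic L c.D.gramW)
    (kind : InfinitePlace (L : Type) → PlaceKind) (lam : InfinitePlace (L : Type) → ℂ) (hlam : ∀ w, lam w ≠ 0)
    (t : (printPlaces (InfinitePlace (L : Type)) kind lam hlam
      (pinnedVacs kind (cR12 hHD hI h₁ h₃ h hA W S μ V c).m₁ (cR12 hHD hI h₁ h₃ h hA W S μ V c).m₂)).Tg) :
    Subtype.val ((cC hHD hI h₁ h₃ h hA W S).chart12 (cR12 hHD hI h₁ h₃ h hA W S μ) V c kind lam hlam t) =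
      printedTorusHom kind lam hlam (c.D.jT₁₂.toMonoidHom.comp (toAdeles (L : Type)))
        (pinnedVacs kind (cR12 hHD hI h₁ h₃ h hA W S μ V c).m₁ (cR12 hHD hI h₁ h₃ h hA W S μ V c).m₂) t := by
  exact StubTree.SeesawDatum.subtype_jT₁₂Model_apply c.D printFact_unitaryCompact_holds hW
    (toAdeles (L : Type) ((placesEquiv (L : Type)).symm (placesCoord (InfinitePlace (L : Type)) kind lam hlam _ t)))

/-- DICTIONARY 5′: the canonical (34) chart on adelic matrices (regime of `U(W)`). -/
theorem val_chart34 [DecidableEq (InfinitePlace (L : Type))] (hW : IsAnisotropic L c.D.gramW)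
    (kind : InfinitePlace (L : Type) → PlaceKind) (lam : InfinitePlace (L : Type) → ℂ) (hlam : ∀ w, lam w ≠ 0)
    (t : (printPlaces (InfinitePlace (L : Type)) kind lam hlam
      (pinnedVacs kind (cR34 hHD hI h₁ h₃ h hA W S μ V c).m₁ (cR34 hHD hI h₁ h₃ h hA W S μ V c).m₂)).Tg) :
    Subtype.val ((cC hHD hI h₁ h₃ h hA W S).chart34 (cR34 hHD hI h₁ h₃ h hA W S μ) V c kind lam hlam t) =
      printedTorusHom kind lam hlam (c.D.jT₃₄.toMonoidHom.comp (toAdeles (L : Type)))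
        (pinnedVacs kind (cR34 hHD hI h₁ h₃ h hA W S μ V c).m₁ (cR34 hHD hI h₁ h₃ h hA W S μ V c).m₂) t := by
  exact StubTree.SeesawDatum.subtype_jT₃₄Model_apply c.D printFact_unitaryCompact_holds hW
    (toAdeles (L : Type) ((placesEquiv (L : Type)).symm (placesCoord (InfinitePlace (L : Type)) kind lam hlam _ t)))

end Pin

/-! ## §3 E's `hyp12` from a `HypCoreW` per good sextic context -/

section E12

variable (hHD : exists_isReal_hodgeModel) (hI : hodgePQ_independent_of_hodgeModel)
  (h₁ : BallQuotientUniformised)  (h₃ : CMAbelianVarietyRealised)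
variable (h : Bool) (hA : Arapura2012_Cor_15_4_6)
  (W : ∀ {L : CMField} {ι₁ : L →+* ℂ} (V : HermSpace3 L ι₁) (c : SeesawCtx L), WmInput V c.D)
  (S : ∀ {L : CMField} {ι₁ : L →+* ℂ} (V : HermSpace3 L ι₁) (c : SeesawCtx L), ThetaAdelicSide V c)
  (μ : ∀ {L : CMField}, SeesawCtx L → Fin 4 → InfinitePlace L → ℤ)
variable {L : CMField} {ι₁ : L →+* ℂ} (V : HermSpace3 L ι₁) (c : SeesawCtx L)

/-- **The END STATE's six-field (12) side of the pin from a `HypSideW` of `W V c`** (regime of `U(W)`). -/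
def hypSmoothSide12_of_sideW (hW : IsAnisotropic L c.D.gramW) [DecidableEq (InfinitePlace (L : Type))]
    (kind : InfinitePlace (L : Type) → PlaceKind) (lam : InfinitePlace (L : Type) → ℂ) (hlam : ∀ w, lam w ≠ 0)
    (A : HypSideW (W V c) c.D.jT₁₂ kind lam hlam
      (cR12 hHD hI h₁ h₃ h hA W S μ V c).m₁ (cR12 hHD hI h₁ h₃ h hA W S μ V c).m₂) :
    letI : ((cC hHD hI h₁ h₃ h hA W S).wm V c).LinearStr := linOfInput W V c
    HypSmoothSide ((cpinT hHD hI h₁ h₃ h hA W S μ).core V c)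
      ((cC hHD hI h₁ h₃ h hA W S).pointedCore (cR12 hHD hI h₁ h₃ h hA W S μ) (cR34 hHD hI h₁ h₃ h hA W S μ)
        (((cC hHD hI h₁ h₃ h hA W S).analyticKM (cR12 hHD hI h₁ h₃ h hA W S μ)
          (cR34 hHD hI h₁ h₃ h hA W S μ)).toAnalytic) V c)
      (InfinitePlace (L : Type)) kind lam hlam
      (pinnedVacs kind (cR12 hHD hI h₁ h₃ h hA W S μ V c).m₁ (cR12 hHD hI h₁ h₃ h hA W S μ V c).m₂)
      ((cC hHD hI h₁ h₃ h hA W S).chart12 (cR12 hHD hI h₁ h₃ h hA W S μ) V c kind lam hlam) := by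
  letI : ((cC hHD hI h₁ h₃ h hA W S).wm V c).LinearStr := linOfInput W V c
  exact
  { FinIdx := A.FinIdx
    ins := fun f => insM printFact_unitaryCompact_holds (W V c) c.D.jT₁₂ kind lam hlam _ _ A f
    dense := dense_insM printFact_unitaryCompact_holds (W V c) c.D.jT₁₂ kind lam hlam _ _ A
    omg_ins := fun f t φ => omg_insM printFact_unitaryCompact_holds (W V c) c.D.jT₁₂ kind lam hlam _ _ A hW f t φ
    e := fun b u s => eM (W V c) c.D.jT₁₂ kind lam hlam _ _ A hW b u s
    smooth := fun b u f φ => smooth_insM printFact_unitaryCompact_holds (W V c) c.D.jT₁₂ kind lam hlam _ _ A hW b u f φ }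

/-- **A `HypCoreW` of `W V c` at the (12) exponents gives the END STATE's `HypSmoothCore12` of the pin** (regime of `U(W)`). -/
theorem nonempty_hypSmoothCore12_of_coreW (hW : IsAnisotropic L c.D.gramW)
    (A : HypCoreW (W V c) c.D.jT₁₂ (cR12 hHD hI h₁ h₃ h hA W S μ V c).m₁ (cR12 hHD hI h₁ h₃ h hA W S μ V c).m₂) :
    Nonempty ((cC hHD hI h₁ h₃ h hA W S).HypSmoothCore12 (cR12 hHD hI h₁ h₃ h hA W S μ)
      (cR34 hHD hI h₁ h₃ h hA W S μ)
      (((cC hHD hI h₁ h₃ h hA W S).analyticKM (cR12 hHD hI h₁ h₃ h hA W S μ)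
        (cR34 hHD hI h₁ h₃ h hA W S μ)).toAnalytic) V c (ℓ := linOfInput W V c)) :=
  letI := A.decEq
  letI : ((cC hHD hI h₁ h₃ h hA W S).wm V c).LinearStr := linOfInput W V c
  ⟨{ decEq := A.decEq
     kind := A.kind
     lam := A.lam
     hlam := A.hlam
     side := hypSmoothSide12_of_sideW hHD hI h₁ h₃ h hA W S μ V c hW A.kind A.lam A.hlam A.side }⟩

/-- **E's binder `hyp12` IN ITS QUANTIFIED FORM, VERBATIM**, from one `HypCoreW` of `W V c` (torus `jT₁₂`, exponents
`(-μ c 0, -μ c 1)`) per good sextic context; the regime of `U(W)` is derived from the context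
(binder-1 `isAnisotropic_gramW_of_goodCtx`). -/
theorem hyp12_of_sideW
    (J : ∀ {L : CMField} {ι₁ : L →+* ℂ} (V : HermSpace3 L ι₁) (c : SeesawCtx L),
      (cpinT hHD hI h₁ h₃ h hA W S μ).GoodCtx ι₁ c → Module.finrank ℚ c.K = 6 →
      Nonempty (HypCoreW (W V c) c.D.jT₁₂ (fun w => -μ c 0 w) (fun w => -μ c 1 w))) :
    ∀ {L : CMField} {ι₁ : L →+* ℂ} (V : HermSpace3 L ι₁) (c : SeesawCtx L),
      (thetaModelOf hHD hI h₁ h₃ h (embOf hHD hI h₁ h₃) (coverOf hHD hI h₁ h₃ hA) (wmOfInput W) (thetaOf _ (thetaClassInputOf _ (fun V c => thetaSpaceInputOf hHD hI h₁ h₃ S V c))) (d12Of μ) (d34Of μ)).GoodCtx ι₁ c → Module.finrank ℚ c.K = 6 →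
      Nonempty (((coreOf _ (embOf hHD hI h₁ h₃) (coverOf hHD hI h₁ h₃ hA) (wmOfInput W) (thetaOf _ (thetaClassInputOf _ (fun V c => thetaSpaceInputOf hHD hI h₁ h₃ S V c)))).toCore h).HypSmoothCore12
        (((coreOf _ (embOf hHD hI h₁ h₃) (coverOf hHD hI h₁ h₃ hA) (wmOfInput W) (thetaOf _ (thetaClassInputOf _ (fun V c => thetaSpaceInputOf hHD hI h₁ h₃ S V c)))).toCore h).side12 (d12Of μ)) (((coreOf _ (embOf hHD hI h₁ h₃) (coverOf hHD hI h₁ h₃ hA) (wmOfInput W) (thetaOf _ (thetaClassInputOf _ (fun V c => thetaSpaceInputOf hHD hI h₁ h₃ S V c)))).toCore h).side34 (d34Of μ))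
        ((((coreOf _ (embOf hHD hI h₁ h₃) (coverOf hHD hI h₁ h₃ hA) (wmOfInput W) (thetaOf _ (thetaClassInputOf _ (fun V c => thetaSpaceInputOf hHD hI h₁ h₃ S V c)))).toCore h).analyticKM (((coreOf _ (embOf hHD hI h₁ h₃) (coverOf hHD hI h₁ h₃ hA) (wmOfInput W) (thetaOf _ (thetaClassInputOf _ (fun V c => thetaSpaceInputOf hHD hI h₁ h₃ S V c)))).toCore h).side12 (d12Of μ))
          (((coreOf _ (embOf hHD hI h₁ h₃) (coverOf hHD hI h₁ h₃ hA) (wmOfInput W) (thetaOf _ (thetaClassInputOf _ (fun V c => thetaSpaceInputOf hHD hI h₁ h₃ S V c)))).toCore h).side34 (d34Of μ))).toAnalytic) V c (ℓ := linOfInput W V c)) :=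
  fun V c hc hK =>
    (J V c hc hK).elim fun A =>
      nonempty_hypSmoothCore12_of_coreW hHD hI h₁ h₃ h hA W S μ V c
        ((cpinC hHD hI h₁ h₃ hA W S).isAnisotropic_gramW_of_goodCtx h (d12Of μ) (d34Of μ) hc) A

end E12

/-! ## §4 E's `hyp34` from a `HypCoreW` per good sextic context -/

section E34

variable (hHD : exists_isReal_hodgeModel) (hI : hodgePQ_independent_of_hodgeModel)
  (h₁ : BallQuotientUniformised)  (h₃ : CMAbelianVarietyRealised)
variable (h : Bool) (hA : Arapura2012_Cor_15_4_6)
  (W : ∀ {L : CMField} {ι₁ : L →+* ℂ} (V : HermSpace3 L ι₁) (c : SeesawCtx L), WmInput V c.D)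
  (S : ∀ {L : CMField} {ι₁ : L →+* ℂ} (V : HermSpace3 L ι₁) (c : SeesawCtx L), ThetaAdelicSide V c)
  (μ : ∀ {L : CMField}, SeesawCtx L → Fin 4 → InfinitePlace L → ℤ)
variable {L : CMField} {ι₁ : L →+* ℂ} (V : HermSpace3 L ι₁) (c : SeesawCtx L)

/-- **The END STATE's six-field (34) side of the pin from a `HypSideW` of `W V c` for `jT₃₄`** (regime of `U(W)`). -/
def hypSmoothSide34_of_sideW (hW : IsAnisotropic L c.D.gramW) [DecidableEq (InfinitePlace (L : Type))]
    (kind : InfinitePlace (L : Type) → PlaceKind) (lam : InfinitePlace (L : Type) → ℂ) (hlam : ∀ w, lam w ≠ 0)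
    (A : HypSideW (W V c) c.D.jT₃₄ kind lam hlam
      (cR34 hHD hI h₁ h₃ h hA W S μ V c).m₁ (cR34 hHD hI h₁ h₃ h hA W S μ V c).m₂) :
    letI : ((cC hHD hI h₁ h₃ h hA W S).wm V c).LinearStr := linOfInput W V c
    HypSmoothSide ((cpinT hHD hI h₁ h₃ h hA W S μ).core V c)
      ((cC hHD hI h₁ h₃ h hA W S).pointedCore (cR12 hHD hI h₁ h₃ h hA W S μ) (cR34 hHD hI h₁ h₃ h hA W S μ)
        (((cC hHD hI h₁ h₃ h hA W S).analyticKM (cR12 hHD hI h₁ h₃ h hA W S μ)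
          (cR34 hHD hI h₁ h₃ h hA W S μ)).toAnalytic) V c)
      (InfinitePlace (L : Type)) kind lam hlam
      (pinnedVacs kind (cR34 hHD hI h₁ h₃ h hA W S μ V c).m₁ (cR34 hHD hI h₁ h₃ h hA W S μ V c).m₂)
      ((cC hHD hI h₁ h₃ h hA W S).chart34 (cR34 hHD hI h₁ h₃ h hA W S μ) V c kind lam hlam) := by
  letI : ((cC hHD hI h₁ h₃ h hA W S).wm V c).LinearStr := linOfInput W V c
  exact
  { FinIdx := A.FinIdx
    ins := fun f => insM printFact_unitaryCompact_holds (W V c) c.D.jT₃₄ kind lam hlam _ _ A f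
    dense := dense_insM printFact_unitaryCompact_holds (W V c) c.D.jT₃₄ kind lam hlam _ _ A
    omg_ins := fun f t φ => omg_insM printFact_unitaryCompact_holds (W V c) c.D.jT₃₄ kind lam hlam _ _ A hW f t φ
    e := fun b u s => eM (W V c) c.D.jT₃₄ kind lam hlam _ _ A hW b u s
    smooth := fun b u f φ => smooth_insM printFact_unitaryCompact_holds (W V c) c.D.jT₃₄ kind lam hlam _ _ A hW b u f φ }

/-- **A `HypCoreW` of `W V c` for `jT₃₄` at the (34) exponents gives the END STATE's `HypSmoothCore34` of the pin.** -/
theorem nonempty_hypSmoothCore34_of_coreW (hW : IsAnisotropic L c.D.gramW)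
    (A : HypCoreW (W V c) c.D.jT₃₄ (cR34 hHD hI h₁ h₃ h hA W S μ V c).m₁ (cR34 hHD hI h₁ h₃ h hA W S μ V c).m₂) :
    Nonempty ((cC hHD hI h₁ h₃ h hA W S).HypSmoothCore34 (cR12 hHD hI h₁ h₃ h hA W S μ)
      (cR34 hHD hI h₁ h₃ h hA W S μ)
      (((cC hHD hI h₁ h₃ h hA W S).analyticKM (cR12 hHD hI h₁ h₃ h hA W S μ)
        (cR34 hHD hI h₁ h₃ h hA W S μ)).toAnalytic) V c (ℓ := linOfInput W V c)) :=
  letI := A.decEq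
  letI : ((cC hHD hI h₁ h₃ h hA W S).wm V c).LinearStr := linOfInput W V c
  ⟨{ decEq := A.decEq
     kind := A.kind
     lam := A.lam
     hlam := A.hlam
     side := hypSmoothSide34_of_sideW hHD hI h₁ h₃ h hA W S μ V c hW A.kind A.lam A.hlam A.side }⟩

/-- **E's binder `hyp34` IN ITS QUANTIFIED FORM, VERBATIM**, from one `HypCoreW` of `W V c` (torus `jT₃₄`, exponents
`(-μ c 2, -μ c 3)`) per good sextic context. -/
theorem hyp34_of_sideW
    (J : ∀ {L : CMField} {ι₁ : L →+* ℂ} (V : HermSpace3 L ι₁) (c : SeesawCtx L),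
      (cpinT hHD hI h₁ h₃ h hA W S μ).GoodCtx ι₁ c → Module.finrank ℚ c.K = 6 →
      Nonempty (HypCoreW (W V c) c.D.jT₃₄ (fun w => -μ c 2 w) (fun w => -μ c 3 w))) :
    ∀ {L : CMField} {ι₁ : L →+* ℂ} (V : HermSpace3 L ι₁) (c : SeesawCtx L),
      (thetaModelOf hHD hI h₁ h₃ h (embOf hHD hI h₁ h₃) (coverOf hHD hI h₁ h₃ hA) (wmOfInput W) (thetaOf _ (thetaClassInputOf _ (fun V c => thetaSpaceInputOf hHD hI h₁ h₃ S V c))) (d12Of μ) (d34Of μ)).GoodCtx ι₁ c → Module.finrank ℚ c.K = 6 →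
      Nonempty (((coreOf _ (embOf hHD hI h₁ h₃) (coverOf hHD hI h₁ h₃ hA) (wmOfInput W) (thetaOf _ (thetaClassInputOf _ (fun V c => thetaSpaceInputOf hHD hI h₁ h₃ S V c)))).toCore h).HypSmoothCore34
        (((coreOf _ (embOf hHD hI h₁ h₃) (coverOf hHD hI h₁ h₃ hA) (wmOfInput W) (thetaOf _ (thetaClassInputOf _ (fun V c => thetaSpaceInputOf hHD hI h₁ h₃ S V c)))).toCore h).side12 (d12Of μ)) (((coreOf _ (embOf hHD hI h₁ h₃) (coverOf hHD hI h₁ h₃ hA) (wmOfInput W) (thetaOf _ (thetaClassInputOf _ (fun V c => thetaSpaceInputOf hHD hI h₁ h₃ S V c)))).toCore h).side34 (d34Of μ))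
        ((((coreOf _ (embOf hHD hI h₁ h₃) (coverOf hHD hI h₁ h₃ hA) (wmOfInput W) (thetaOf _ (thetaClassInputOf _ (fun V c => thetaSpaceInputOf hHD hI h₁ h₃ S V c)))).toCore h).analyticKM (((coreOf _ (embOf hHD hI h₁ h₃) (coverOf hHD hI h₁ h₃ hA) (wmOfInput W) (thetaOf _ (thetaClassInputOf _ (fun V c => thetaSpaceInputOf hHD hI h₁ h₃ S V c)))).toCore h).side12 (d12Of μ))
          (((coreOf _ (embOf hHD hI h₁ h₃) (coverOf hHD hI h₁ h₃ hA) (wmOfInput W) (thetaOf _ (thetaClassInputOf _ (fun V c => thetaSpaceInputOf hHD hI h₁ h₃ S V c)))).toCore h).side34 (d34Of μ))).toAnalytic) V c (ℓ := linOfInput W V c)) :=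
  fun V c hc hK =>
    (J V c hc hK).elim fun A =>
      nonempty_hypSmoothCore34_of_coreW hHD hI h₁ h₃ h hA W S μ V c
        ((cpinC hHD hI h₁ h₃ hA W S).isAnisotropic_gramW_of_goodCtx h (d12Of μ) (d34Of μ) hc) A

end E34

end HodgeCM.Model.HypCensus

end
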